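import Literature.AlgebraicGeometry.ShimuraVarieties.UnitaryShimuraComplexRecordSystem
import Literature.AlgebraicGeometry.Motives.BaseChangeAlgebraicExtension
import HarnessLib

/-!
# Base change of forms with Shimura reciprocity along a tower `E′ → E → ℂ` (the «tower lemma»)

Topic `AlgebraicGeometry/ShimuraVarieties`; namespace `Literature.AlgebraicGeometry.ShimuraVarieties`, grouping
sub-namespace `UnitaryCanonicalModel`.  THEOREMS ONLY (no definition, no named fact; nothing under `Summits/` is used;
no binder of any cell is discharged; HC_CM is not mentioned).

Setting: the compact unitary Shimura surfaces `Sh(U(H), 𝔹²)` of the tree (`UnitaryCanonicalModel.ComplexRecordSystem`: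
the complex tower `K ↦ Sc.Mc_K` below a small level `K₀`, `Sc.pts_K : Mc_K(ℂ) ≃ₜ Sh_K(ℂ)`) and FORMS of that tower over a
field `E` with a complex embedding `ιE : E →+* ℂ`: a functor `M : C5.SmallLevel K₀ ⥤ SchemeOver E` with an isomorphism
`e : M ⋙ baseChangeHom ιE ≅ Sc.Mc` ([Deligne1979ShimuraVarieties] 2.2.5 «form»; for `(E, ιE) = (L, τ)` the datum of
`UnitaryCanonicalModel.IsCanonicalDescentAt`).  Shimura reciprocity (62) of [Milne2005ShimuraVarieties] Def. 12.8 at the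
diagonal special pairs is the formula of `IsCanonicalDescentAt` with base `(E, ιE)` in place of `(L, τ)`; it is written
out VERBATIM (the body of the consumer statements of cell `hodgecm-mathlib`, line `a1-reflex-compositum`, stub
`stub_reflexCompositumModel`); no new predicate is introduced here.

Content (all PROVED):

* §1 (pure algebraic geometry, fields `k′ →j k →ι Ω`, `ι ∘ j = ι′`): the transitivity isomorphism
  `(X ⊗_j k) ⊗_ι Ω ≅ X ⊗_{ι′} Ω` of the tree (`Motives.baseChangeHomObjIsoOfComp`, [GortzWedhorn2020] Prop. 4.16) is
  compatible with reading `Ω`-points (`AlgPoints.baseChangeEquiv`) and with the Galois actions: if `σ′ ∈ Aut(Ω/k′)` is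
  `σ ∈ Aut(Ω/k)` regarded over the smaller field, then «`σ′ • R₁ = R₂` in `X(Ω)`» implies «`σ • R₁ = R₂` in
  `(X ⊗_j k)(Ω)`» (`smul_baseChangeEquiv_symm_eq_of_tower`) — a point of `X ×_{k′} Spec k` is determined by its two
  projections ([Hartshorne1977] II.3 Thm. 3.3).
* §2 `exists_comp_eq_of_range_subset`: `ι′(E′) ⊆ ι(E) ⊆ Ω` gives `j : E′ → E` with `ι ∘ j = ι′`.
* §3 the TOWER LEMMA `reciprocity_baseChange_tower`: an `E′`-form `(M′, e′)` with reciprocity for `Aut(ℂ/E′)` gives,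
  for `j : E′ → E` with `ιE ∘ j = ιE′`, the `E`-form `M′ ⊗_{E′} E = M′ ⋙ baseChangeHom j` with a form isomorphism `e`
  and reciprocity for the SMALLER group `Aut(ℂ/E)`; corollaries `exists_form_of_comp_eq` (`∃ M e`),
  `exists_form_of_range_subset` (hypothesis `ιE′(E′) ⊆ ιE(E)` only) and `forall_exists_form_of_subset_closure` (one form
  over a field whose image lies in the subfield generated by `τ(L) ∪ S` gives forms over EVERY `E` with
  `τ(L) ∪ S ⊆ ιE(E)` — the `∀ E`-clause of the consumer, `S` standing for the reflex-trace field `E*(Φ)`).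

This is the (elementary) bookkeeping half of «weakly canonical models are stable under extension of the base field
`E ⊃ E(G,X)`» ([Deligne1971TravauxShimura] Déf. 3.13 p. 141 defines weakly canonical models over any `E ⊃ E(G,h)`;
Prop. 5.10 p. 157 uses `M_E ⊗_E E_i`; [Milne2005ShimuraVarieties] Def. 12.8 p. 114: (62) is a condition on «every
automorphism of `ℂ` fixing `E(x)`», hence weaker over a bigger base field).  Deliberately NOT here: descent from `E` to a
smaller field ([Deligne1979ShimuraVarieties] §2.7, [Deligne1971TravauxShimura] Prop. 5.10), which is not formal.

## References
* [Deligne1971TravauxShimura] P. Deligne, *Travaux de Shimura*, Sém. Bourbaki 389, LNM 244 (1971): Déf. 3.13, Prop. 5.10.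
* [Deligne1979ShimuraVarieties] P. Deligne, *Variétés de Shimura* (1979), 2.2.5 (PDF p. 29 of Milne's translation).
* [Milne2005ShimuraVarieties] J. S. Milne, *Introduction to Shimura varieties* (2005/2017), Def. 12.8 (62) p. 114.
* [GortzWedhorn2020] Görtz–Wedhorn, *Algebraic Geometry I*, Prop. 4.16; [Hartshorne1977] II.3 Thm. 3.3; [Lang2002] V §1.
-/

set_option autoImplicit false

noncomputable section

open Function MulAction NumberField IsDedekindDomain CategoryTheory CategoryTheory.Limits Matrix
  AlgebraicGeometry
open scoped Matrix ComplexOrder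
open Literature.AlgebraicGeometry.Motives
open Literature.NumberTheory.Automorphic Literature.NumberTheory.Automorphic.UnitaryGroup
open Literature.NumberTheory.Automorphic.Liu2021.AppendixC (C5.OpenCompactSubgroup C5.SmallLevel)
open Literature.Geometry.ComplexHyperbolic Literature.Geometry.ComplexHyperbolic.BallModel
open Literature.NumberTheory.Automorphic.ShimuraDissection

namespace Literature.AlgebraicGeometry.ShimuraVarieties

namespace UnitaryCanonicalModel

/-! ### §1. Points of `X ⊗_{ι′} Ω` versus points of `(X ⊗_j k) ⊗_ι Ω` for `ι ∘ j = ι′`, and the Galois actions -/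

section Tower

variable {k' k Ω : Type} [Field k'] [Field k] [Field Ω] (j : k' →+* k) (ι : k →+* Ω) (ι' : k' →+* Ω)
  (hj : ι.comp j = ι') (X : SchemeOver k')

/-- The INVERSE of the transitivity isomorphism `(X ⊗_j k) ⊗_ι Ω ≅ X ⊗_{ι′} Ω` (`Motives.baseChangeHomObjIsoOfComp`)
commutes with the projections to `X`: `e⁻¹ ≫ pr ≫ pr = pr` (Görtz–Wedhorn I, Prop. 4.16).
[cite: GortzWedhorn2020, Prop. 4.16 and §(4.7)] -/
@[reassoc]
theorem baseChangeHomObjIsoOfComp_inv_left_fst_fst :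
    (baseChangeHomObjIsoOfComp j ι ι' hj X).inv.left ≫ baseChangeHomFst ι ((baseChangeHom j).obj X) ≫
        baseChangeHomFst j X = baseChangeHomFst ι' X := by
  rw [← baseChangeHomObjIsoOfComp_hom_left_fst j ι ι' hj X, ← Over.comp_left_assoc, Iso.inv_hom_id, Over.id_left,
    Category.id_comp]

/-- An `Ω`-point `R` of `X ⊗_{ι′} Ω`, read as an `Ω`-point of `X ⊗_j k` over `k` (through the transitivity isomorphism and
`AlgPoints.baseChangeEquiv ι`) and projected to `X`, is `R` read as an `Ω`-point of `X` over `k′`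
(`AlgPoints.baseChangeEquiv ι′`): both are `R ≫ pr` (Hartshorne II.3 Thm. 3.3; Görtz–Wedhorn I, Prop. 4.16).  Stated on
the underlying morphisms `Spec Ω → X` (`AlgPoints.toSpecHom`). [cite: GortzWedhorn2020, Prop. 4.16 and §(4.7)] -/
theorem toSpecHom_baseChangeEquiv_symm_map_isoOfComp_inv_fst (R : AlgPoints ((baseChangeHom ι').obj X) Ω) :
    (letI : Algebra k Ω := ι.toAlgebra
     AlgPoints.toSpecHom ((AlgPoints.baseChangeEquiv ι ((baseChangeHom j).obj X)).symm
        (AlgPoints.map (baseChangeHomObjIsoOfComp j ι ι' hj X).inv R))) ≫ baseChangeHomFst j X =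
      (letI : Algebra k' Ω := ι'.toAlgebra; AlgPoints.toSpecHom ((AlgPoints.baseChangeEquiv ι' X).symm R)) := by
  change (letI : Algebra k Ω := ι.toAlgebra
     ((AlgPoints.baseChangeEquiv ι ((baseChangeHom j).obj X)).symm
        (AlgPoints.map (baseChangeHomObjIsoOfComp j ι ι' hj X).inv R)).left) ≫ baseChangeHomFst j X =
      (letI : Algebra k' Ω := ι'.toAlgebra; ((AlgPoints.baseChangeEquiv ι' X).symm R).left)
  rw [AlgPoints.baseChangeEquiv_symm_apply_left, AlgPoints.baseChangeEquiv_symm_apply_left, AlgPoints.map_apply,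
    Over.comp_left]
  change ((R.left ≫ (baseChangeHomObjIsoOfComp j ι ι' hj X).inv.left) ≫ baseChangeHomFst ι ((baseChangeHom j).obj X)) ≫
      baseChangeHomFst j X = R.left ≫ baseChangeHomFst ι' X
  simp only [Category.assoc, baseChangeHomObjIsoOfComp_inv_left_fst_fst]

/-- **Galois transfer along a tower** (the point-level heart of the tower lemma): let `ι ∘ j = ι′ : k′ → k → Ω`, let
`σ ∈ Aut(Ω/ι k)` and `σ′ ∈ Aut(Ω/ι′ k′)` have the same underlying map (i.e. `σ′` is `σ` regarded over the smaller
field), and let `R₁, R₂` be `Ω`-points of `X ⊗_{ι′} Ω`.  If `σ′` carries `R₁` to `R₂` as `Ω`-points of `X` over `k′`,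
then `σ` carries `R₁` to `R₂` as `Ω`-points of `X ⊗_j k` over `k` (both read through `AlgPoints.baseChangeEquiv` and
the transitivity isomorphism).  Proof: a point of `X ⊗_j k = X ×_{Spec k′} Spec k` is determined by its two projections
(Hartshorne II.3 Thm. 3.3); the projection to `X` is the hypothesis, the projection to `Spec k` is fixed by `σ`.
[cite: Hartshorne1977, II.3 Thm. 3.3 and II Ex. 4.7] [cite: GortzWedhorn2020, Prop. 4.16] -/
theorem smul_baseChangeEquiv_symm_eq_of_tower (R₁ R₂ : AlgPoints ((baseChangeHom ι').obj X) Ω)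
    (σ : letI : Algebra k Ω := ι.toAlgebra; Ω ≃ₐ[k] Ω) (σ' : letI : Algebra k' Ω := ι'.toAlgebra; Ω ≃ₐ[k'] Ω)
    (hσ : ∀ z : Ω, (letI : Algebra k Ω := ι.toAlgebra; σ z) = (letI : Algebra k' Ω := ι'.toAlgebra; σ' z))
    (h : letI : Algebra k' Ω := ι'.toAlgebra
      σ' • (AlgPoints.baseChangeEquiv ι' X).symm R₁ = (AlgPoints.baseChangeEquiv ι' X).symm R₂) :
    letI : Algebra k Ω := ι.toAlgebra
    σ • (AlgPoints.baseChangeEquiv ι ((baseChangeHom j).obj X)).symm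
        (AlgPoints.map (baseChangeHomObjIsoOfComp j ι ι' hj X).inv R₁) =
      (AlgPoints.baseChangeEquiv ι ((baseChangeHom j).obj X)).symm
        (AlgPoints.map (baseChangeHomObjIsoOfComp j ι ι' hj X).inv R₂) := by
  letI : Algebra k Ω := ι.toAlgebra
  letI : Algebra k' Ω := ι'.toAlgebra
  have hσ' : (σ : Ω →+* Ω) = (σ' : Ω →+* Ω) := RingHom.ext hσ
  -- the hypothesis on underlying morphisms `Spec Ω → X`
  have hleft : Spec.map (CommRingCat.ofHom (σ' : Ω →+* Ω)) ≫
      AlgPoints.toSpecHom ((AlgPoints.baseChangeEquiv ι' X).symm R₁) =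
        AlgPoints.toSpecHom ((AlgPoints.baseChangeEquiv ι' X).symm R₂) := by
    have h₁ := congrArg (fun P => P.left) h
    rw [AlgPoints.smul_left] at h₁
    exact h₁
  -- (1) projections to `X`
  have H₁ : (Spec.map (CommRingCat.ofHom (σ : Ω →+* Ω)) ≫
      AlgPoints.toSpecHom ((AlgPoints.baseChangeEquiv ι ((baseChangeHom j).obj X)).symm
        (AlgPoints.map (baseChangeHomObjIsoOfComp j ι ι' hj X).inv R₁))) ≫ baseChangeHomFst j X =
      AlgPoints.toSpecHom ((AlgPoints.baseChangeEquiv ι ((baseChangeHom j).obj X)).symm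
        (AlgPoints.map (baseChangeHomObjIsoOfComp j ι ι' hj X).inv R₂)) ≫ baseChangeHomFst j X := by
    rw [Category.assoc, toSpecHom_baseChangeEquiv_symm_map_isoOfComp_inv_fst,
      toSpecHom_baseChangeEquiv_symm_map_isoOfComp_inv_fst, hσ', hleft]
  -- (2) structure maps to `Spec k`
  have w₁ : AlgPoints.toSpecHom ((AlgPoints.baseChangeEquiv ι ((baseChangeHom j).obj X)).symm
        (AlgPoints.map (baseChangeHomObjIsoOfComp j ι ι' hj X).inv R₁)) ≫ ((baseChangeHom j).obj X).hom =
      (specOver k Ω).hom := Over.w _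
  have w₂ : AlgPoints.toSpecHom ((AlgPoints.baseChangeEquiv ι ((baseChangeHom j).obj X)).symm
        (AlgPoints.map (baseChangeHomObjIsoOfComp j ι ι' hj X).inv R₂)) ≫ ((baseChangeHom j).obj X).hom =
      (specOver k Ω).hom := Over.w _
  have H₂ : (Spec.map (CommRingCat.ofHom (σ : Ω →+* Ω)) ≫
      AlgPoints.toSpecHom ((AlgPoints.baseChangeEquiv ι ((baseChangeHom j).obj X)).symm
        (AlgPoints.map (baseChangeHomObjIsoOfComp j ι ι' hj X).inv R₁))) ≫ ((baseChangeHom j).obj X).hom =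
      AlgPoints.toSpecHom ((AlgPoints.baseChangeEquiv ι ((baseChangeHom j).obj X)).symm
        (AlgPoints.map (baseChangeHomObjIsoOfComp j ι ι' hj X).inv R₂)) ≫ ((baseChangeHom j).obj X).hom := by
    rw [Category.assoc, w₁, w₂]
    exact Over.w (AlgPoints.specMap σ)
  apply Over.OverMorphism.ext
  rw [AlgPoints.smul_left]
  exact pullback.hom_ext H₁ H₂

/-- **Galois transfer along a tower, for points read through a morphism `φ′ : Z → X ⊗_{ι′} Ω`** (the shape the tower
lemma consumes): `Ω`-points `P₁, P₂` of an `Ω`-scheme `Z` are read in `X(Ω)` through `φ′` and in `(X ⊗_j k)(Ω)` through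
`φ = φ′ ≫ e⁻¹` (`e` the transitivity isomorphism; `φ` a free variable with a propositional equation); if `σ′` carries the
first reading of `P₁` to that of `P₂`, then `σ` carries the second reading of `P₁` to that of `P₂`.
[cite: Hartshorne1977, II.3 Thm. 3.3 and II Ex. 4.7] [cite: GortzWedhorn2020, Prop. 4.16] -/
theorem smul_baseChangeEquiv_symm_map_eq_of_tower {Z : SchemeOver Ω} (φ' : Z ⟶ (baseChangeHom ι').obj X)
    (φ : Z ⟶ (baseChangeHom ι).obj ((baseChangeHom j).obj X))
    (hφ : φ = φ' ≫ (baseChangeHomObjIsoOfComp j ι ι' hj X).inv) (P₁ P₂ : AlgPoints Z Ω)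
    (σ : letI : Algebra k Ω := ι.toAlgebra; Ω ≃ₐ[k] Ω) (σ' : letI : Algebra k' Ω := ι'.toAlgebra; Ω ≃ₐ[k'] Ω)
    (hσ : ∀ z : Ω, (letI : Algebra k Ω := ι.toAlgebra; σ z) = (letI : Algebra k' Ω := ι'.toAlgebra; σ' z))
    (h : letI : Algebra k' Ω := ι'.toAlgebra
      σ' • (AlgPoints.baseChangeEquiv ι' X).symm (AlgPoints.map φ' P₁) =
        (AlgPoints.baseChangeEquiv ι' X).symm (AlgPoints.map φ' P₂)) :
    letI : Algebra k Ω := ι.toAlgebra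
    σ • (AlgPoints.baseChangeEquiv ι ((baseChangeHom j).obj X)).symm (AlgPoints.map φ P₁) =
      (AlgPoints.baseChangeEquiv ι ((baseChangeHom j).obj X)).symm (AlgPoints.map φ P₂) := by
  subst hφ
  rw [AlgPoints.map_comp_apply, AlgPoints.map_comp_apply]
  exact smul_baseChangeEquiv_symm_eq_of_tower j ι ι' hj X _ _ σ σ' hσ h

end Tower

/-! ### §2. Factorisation of complex embeddings with nested images -/

/-- If `ι′(E′) ⊆ ι(E)` inside `Ω` for field homomorphisms `ι : E → Ω`, `ι′ : E′ → Ω`, then `ι′` factors as `ι ∘ j`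
for a (unique) `j : E′ → E` — a field homomorphism is injective, so `E ≃ ι(E) ⊇ ι′(E′)` (Lang, *Algebra*, V §1:
homomorphisms of fields are embeddings; an embedding is an isomorphism onto its image). [cite: Lang2002, V §1] -/
theorem exists_comp_eq_of_range_subset {E E' Ω : Type} [Field E] [Field E'] [Field Ω] (ι : E →+* Ω)
    (ι' : E' →+* Ω) (h : Set.range ι' ⊆ Set.range ι) : ∃ j : E' →+* E, ι.comp j = ι' := by
  classical
  have hinj : Function.Injective ι.rangeRestrict := fun a b hab =>
    ι.injective (by simpa only [RingHom.coe_rangeRestrict] using congrArg Subtype.val hab)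
  let ε : E ≃+* ι.range := RingEquiv.ofBijective ι.rangeRestrict ⟨hinj, ι.rangeRestrict_surjective⟩
  let g : E' →+* ι.range := ι'.codRestrict ι.range fun x => RingHom.mem_range.mpr (h ⟨x, rfl⟩)
  refine ⟨ε.symm.toRingHom.comp g, RingHom.ext fun x => ?_⟩
  have h₂ : ((ε (ε.symm (g x)) : ι.range) : Ω) = (g x : Ω) := by rw [ε.apply_symm_apply]
  exact h₂

/-! ### §3. The tower lemma for forms of a complex record system with Shimura reciprocity (62) -/

section Forms

variable {L : Type} [Field L] [NumberField L] [IsCMField L] {H : Matrix (Fin 3) (Fin 3) L} {τ : L →+* ℂ}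
  {T : GL (Fin 3) ℂ} {hT : formCongr (starRingEnd ℂ) T (H.map τ) = BallModel.J}
  {K₀ : C5.OpenCompactSubgroup ↥(finAdelic (↥(maximalRealSubfield L)) L (IsCMField.complexConj L) 3 H)}
  (Sc : ComplexRecordSystem L H τ T hT K₀)

/-- **Tower lemma (base change of a form with reciprocity along `j : E′ → E`, `ιE ∘ j = ιE′`).**  Let `Sc` be a
complex record system of `Sh(U(H), 𝔹²)` below `K₀` and `(M′, e′ : M′ ⊗_{E′,ιE′} ℂ ≅ Sc.Mc)` an `E′`-form of the tower
`K ↦ Sc.Mc_K` on whose complex points `Aut(ℂ/ιE′ E′)` acts at the diagonal special pairs by Shimura reciprocity (62),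
`σ[x, aK] = [x, r_x(s)·aK]` for `art_L(s) = σ|L^{ab}` (the formula of `IsCanonicalDescentAt`, with base `(E′, ιE′)` in
place of `(L, τ)`).  Then the base change `M′ ⊗_{E′} E` (the functor `M′ ⋙ baseChangeHom j`) carries a form
`e : (M′ ⊗_{E′} E) ⊗_{E,ιE} ℂ ≅ Sc.Mc` (levelwise the transitivity isomorphism of Görtz–Wedhorn I Prop. 4.16 composed
with `e′`) on whose complex points the SMALLER group `Aut(ℂ/ιE E) ⊆ Aut(ℂ/ιE′ E′)` acts by the same rule — the
formula with base `(E, ιE)`.  This is the bookkeeping behind «a weakly canonical model over `E ⊃ E(G,X)` stays weakly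
canonical after extending `E`» ([Deligne1971TravauxShimura] Déf. 3.13, and `M_E ⊗_E E_i` in Prop. 5.10;
[Milne2005ShimuraVarieties] Def. 12.8: (62) is asked of «every automorphism of `ℂ` fixing `E(x)`», so of fewer
automorphisms over a bigger base).  Proof: `σ ∈ Aut(ℂ/E)` restricts to `σ′ ∈ Aut(ℂ/E′)` along `j` (same underlying
automorphism, so the same `IsArtinCorrespondent` idèles); a complex point of `M′_K ⊗_{E′} E = M′_K ×_{E′} E` is
determined by its projections to `M′_K` (where the hypothesis applies to `σ′`) and to `Spec E` (fixed by `σ`)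
(`smul_baseChangeEquiv_symm_eq_of_tower`). [cite: Deligne1971TravauxShimura, Déf. 3.13 p. 141 and Prop. 5.10 p. 157]
[cite: Milne2005ShimuraVarieties, Def. 12.8 (62) p. 114] [cite: GortzWedhorn2020, Prop. 4.16] -/
theorem reciprocity_baseChange_tower {E E' : Type} [Field E] [Field E'] (j : E' →+* E) (ιE : E →+* ℂ)
    (ιE' : E' →+* ℂ) (hj : ιE.comp j = ιE') (M' : C5.SmallLevel K₀ ⥤ SchemeOver E')
    (e' : (M' ⋙ baseChangeHom ιE') ≅ Sc.Mc)
    (h' : letI : Algebra E' ℂ := ιE'.toAlgebra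
      ∀ (K : C5.SmallLevel K₀) (σ : ℂ ≃ₐ[E'] ℂ) (s : (FiniteAdeleRing (𝓞 L) L)ˣ),
        IsArtinCorrespondent L τ s σ.toRingEquiv →
        ∀ (v₃ : Fin 3 → L) (x : Ball), IsLinePoint L τ T v₃ x →
          ∀ d : finAdelic (↥(maximalRealSubfield L)) L (IsCMField.complexConj L) 3 H,
            IsDiagTwist L H v₃ (recipFactor L s) d →
            ∀ a : finAdelic (↥(maximalRealSubfield L)) L (IsCMField.complexConj L) 3 H,
              σ • (AlgPoints.baseChangeEquiv ιE' (M'.obj K)).symm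
                  (AlgPoints.map (e'.inv.app K) ((Sc.pts K).symm (ShimuraSet.mk L H τ T hT K.1.1 x a))) =
                (AlgPoints.baseChangeEquiv ιE' (M'.obj K)).symm
                  (AlgPoints.map (e'.inv.app K)
                    ((Sc.pts K).symm (ShimuraSet.mk L H τ T hT K.1.1 x (d * a))))) :
    ∃ e : ((M' ⋙ baseChangeHom j) ⋙ baseChangeHom ιE) ≅ Sc.Mc,
      letI : Algebra E ℂ := ιE.toAlgebra
      ∀ (K : C5.SmallLevel K₀) (σ : ℂ ≃ₐ[E] ℂ) (s : (FiniteAdeleRing (𝓞 L) L)ˣ),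
        IsArtinCorrespondent L τ s σ.toRingEquiv →
        ∀ (v₃ : Fin 3 → L) (x : Ball), IsLinePoint L τ T v₃ x →
          ∀ d : finAdelic (↥(maximalRealSubfield L)) L (IsCMField.complexConj L) 3 H,
            IsDiagTwist L H v₃ (recipFactor L s) d →
            ∀ a : finAdelic (↥(maximalRealSubfield L)) L (IsCMField.complexConj L) 3 H,
              σ • (AlgPoints.baseChangeEquiv ιE ((M' ⋙ baseChangeHom j).obj K)).symm
                  (AlgPoints.map (e.inv.app K) ((Sc.pts K).symm (ShimuraSet.mk L H τ T hT K.1.1 x a))) =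
                (AlgPoints.baseChangeEquiv ιE ((M' ⋙ baseChangeHom j).obj K)).symm
                  (AlgPoints.map (e.inv.app K)
                    ((Sc.pts K).symm (ShimuraSet.mk L H τ T hT K.1.1 x (d * a)))) := by
  letI : Algebra E ℂ := ιE.toAlgebra
  letI : Algebra E' ℂ := ιE'.toAlgebra
  -- KERNEL HYGIENE (compositions in `SchemeOver` are expensive to unfold): never hand the kernel two morphism terms that
  -- agree only up to unfolding (`(F ⋙ G).map f` vs `G.map (F.map f)`, a β-redex `(fun X => ι X) Y` vs `ι Y`) inside a
  -- composition: rewrite with `rfl`-lemmas (`rw`), pass component families un-η-expanded, let the elaborator state goals.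
  -- The form isomorphism: transitivity of base change (natural in the `E′`-scheme), whiskered with `M′`, then `e′`.
  let tI : (baseChangeHom j ⋙ baseChangeHom ιE) ≅ baseChangeHom ιE' :=
    NatIso.ofComponents (baseChangeHomObjIsoOfComp j ιE ιE' hj) (fun f => by
      rw [Functor.comp_map]
      exact baseChangeHomObjIsoOfComp_comm j ιE ιE' hj f)
  let e : ((M' ⋙ baseChangeHom j) ⋙ baseChangeHom ιE) ≅ Sc.Mc :=
    Functor.associator M' (baseChangeHom j) (baseChangeHom ιE) ≪≫ Functor.isoWhiskerLeft M' tI ≪≫ e'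
  refine ⟨e, ?_⟩
  intro K σ s hs v₃ x hx d hd a
  -- at level `K`: `e⁻¹ = e′⁻¹ ≫ (transitivity iso)⁻¹`
  have htI : tI.inv.app (M'.obj K) = (baseChangeHomObjIsoOfComp j ιE ιE' hj (M'.obj K)).inv := rfl
  have hφ : e.inv.app K = e'.inv.app K ≫ (baseChangeHomObjIsoOfComp j ιE ιE' hj (M'.obj K)).inv := by
    simp only [e]
    rw [Iso.trans_inv, NatTrans.comp_app, Iso.trans_inv, NatTrans.comp_app, Functor.isoWhiskerLeft_inv,
      Functor.whiskerLeft_app, htI, Functor.associator_inv_app]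
    exact Category.comp_id _
  -- `σ` regarded over the smaller field `E′` (along `j`): the same automorphism of `ℂ`
  let σ' : ℂ ≃ₐ[E'] ℂ :=
    { σ with
      commutes' := fun y => by
        change σ (ιE' y) = ιE' y
        rw [← hj]
        exact σ.commutes (j y) }
  have hs' : IsArtinCorrespondent L τ s σ'.toRingEquiv := hs
  exact smul_baseChangeEquiv_symm_map_eq_of_tower j ιE ιE' hj (M'.obj K) (e'.inv.app K) (e.inv.app K) hφ
    ((Sc.pts K).symm (ShimuraSet.mk L H τ T hT K.1.1 x a))
    ((Sc.pts K).symm (ShimuraSet.mk L H τ T hT K.1.1 x (d * a))) σ σ' (fun _ => rfl)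
    (h' K σ' s hs' v₃ x hx d hd a)

/-- **Tower lemma, `∃`-form.**  Under the hypotheses of `reciprocity_baseChange_tower` (an `E′`-form of `Sc.Mc` with
reciprocity (62) for `Aut(ℂ/E′)`, and `j : E′ → E` with `ιE ∘ j = ιE′`) there is an `E`-form of `Sc.Mc` with
reciprocity (62) for `Aut(ℂ/E)` — namely `M′ ⊗_{E′} E`.  The conclusion is VERBATIM the `∃ (M) (e), …` clause of the
consumer statements with base `(E, ιE)`. [cite: Deligne1971TravauxShimura, Déf. 3.13 p. 141 and Prop. 5.10 p. 157]
[cite: Milne2005ShimuraVarieties, Def. 12.8 (62) p. 114] -/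
theorem exists_form_of_comp_eq {E E' : Type} [Field E] [Field E'] (j : E' →+* E) (ιE : E →+* ℂ)
    (ιE' : E' →+* ℂ) (hj : ιE.comp j = ιE') (M' : C5.SmallLevel K₀ ⥤ SchemeOver E')
    (e' : (M' ⋙ baseChangeHom ιE') ≅ Sc.Mc)
    (h' : letI : Algebra E' ℂ := ιE'.toAlgebra
      ∀ (K : C5.SmallLevel K₀) (σ : ℂ ≃ₐ[E'] ℂ) (s : (FiniteAdeleRing (𝓞 L) L)ˣ),
        IsArtinCorrespondent L τ s σ.toRingEquiv →
        ∀ (v₃ : Fin 3 → L) (x : Ball), IsLinePoint L τ T v₃ x →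
          ∀ d : finAdelic (↥(maximalRealSubfield L)) L (IsCMField.complexConj L) 3 H,
            IsDiagTwist L H v₃ (recipFactor L s) d →
            ∀ a : finAdelic (↥(maximalRealSubfield L)) L (IsCMField.complexConj L) 3 H,
              σ • (AlgPoints.baseChangeEquiv ιE' (M'.obj K)).symm
                  (AlgPoints.map (e'.inv.app K) ((Sc.pts K).symm (ShimuraSet.mk L H τ T hT K.1.1 x a))) =
                (AlgPoints.baseChangeEquiv ιE' (M'.obj K)).symm
                  (AlgPoints.map (e'.inv.app K)
                    ((Sc.pts K).symm (ShimuraSet.mk L H τ T hT K.1.1 x (d * a))))) :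
    ∃ (M : C5.SmallLevel K₀ ⥤ SchemeOver E) (e : (M ⋙ baseChangeHom ιE) ≅ Sc.Mc),
      letI : Algebra E ℂ := ιE.toAlgebra
      ∀ (K : C5.SmallLevel K₀) (σ : ℂ ≃ₐ[E] ℂ) (s : (FiniteAdeleRing (𝓞 L) L)ˣ),
        IsArtinCorrespondent L τ s σ.toRingEquiv →
        ∀ (v₃ : Fin 3 → L) (x : Ball), IsLinePoint L τ T v₃ x →
          ∀ d : finAdelic (↥(maximalRealSubfield L)) L (IsCMField.complexConj L) 3 H,
            IsDiagTwist L H v₃ (recipFactor L s) d →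
            ∀ a : finAdelic (↥(maximalRealSubfield L)) L (IsCMField.complexConj L) 3 H,
              σ • (AlgPoints.baseChangeEquiv ιE (M.obj K)).symm
                  (AlgPoints.map (e.inv.app K) ((Sc.pts K).symm (ShimuraSet.mk L H τ T hT K.1.1 x a))) =
                (AlgPoints.baseChangeEquiv ιE (M.obj K)).symm
                  (AlgPoints.map (e.inv.app K)
                    ((Sc.pts K).symm (ShimuraSet.mk L H τ T hT K.1.1 x (d * a)))) :=
  ⟨M' ⋙ baseChangeHom j, reciprocity_baseChange_tower Sc j ιE ιE' hj M' e' h'⟩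

/-- **Tower lemma, image form.**  If `Sc.Mc` has an `E′`-form with reciprocity (62) for `Aut(ℂ/E′)` and `ιE′(E′) ⊆ ιE(E)`
inside `ℂ`, then `Sc.Mc` has an `E`-form with reciprocity (62) for `Aut(ℂ/E)` (`exists_comp_eq_of_range_subset` +
`exists_form_of_comp_eq`). [cite: Deligne1971TravauxShimura, Déf. 3.13 p. 141 and Prop. 5.10 p. 157]
[cite: Milne2005ShimuraVarieties, Def. 12.8 (62) p. 114] -/
theorem exists_form_of_range_subset {E E' : Type} [Field E] [Field E'] (ιE : E →+* ℂ) (ιE' : E' →+* ℂ)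
    (hEE : Set.range ιE' ⊆ Set.range ιE) (M' : C5.SmallLevel K₀ ⥤ SchemeOver E')
    (e' : (M' ⋙ baseChangeHom ιE') ≅ Sc.Mc)
    (h' : letI : Algebra E' ℂ := ιE'.toAlgebra
      ∀ (K : C5.SmallLevel K₀) (σ : ℂ ≃ₐ[E'] ℂ) (s : (FiniteAdeleRing (𝓞 L) L)ˣ),
        IsArtinCorrespondent L τ s σ.toRingEquiv →
        ∀ (v₃ : Fin 3 → L) (x : Ball), IsLinePoint L τ T v₃ x →
          ∀ d : finAdelic (↥(maximalRealSubfield L)) L (IsCMField.complexConj L) 3 H,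
            IsDiagTwist L H v₃ (recipFactor L s) d →
            ∀ a : finAdelic (↥(maximalRealSubfield L)) L (IsCMField.complexConj L) 3 H,
              σ • (AlgPoints.baseChangeEquiv ιE' (M'.obj K)).symm
                  (AlgPoints.map (e'.inv.app K) ((Sc.pts K).symm (ShimuraSet.mk L H τ T hT K.1.1 x a))) =
                (AlgPoints.baseChangeEquiv ιE' (M'.obj K)).symm
                  (AlgPoints.map (e'.inv.app K)
                    ((Sc.pts K).symm (ShimuraSet.mk L H τ T hT K.1.1 x (d * a))))) :
    ∃ (M : C5.SmallLevel K₀ ⥤ SchemeOver E) (e : (M ⋙ baseChangeHom ιE) ≅ Sc.Mc),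
      letI : Algebra E ℂ := ιE.toAlgebra
      ∀ (K : C5.SmallLevel K₀) (σ : ℂ ≃ₐ[E] ℂ) (s : (FiniteAdeleRing (𝓞 L) L)ˣ),
        IsArtinCorrespondent L τ s σ.toRingEquiv →
        ∀ (v₃ : Fin 3 → L) (x : Ball), IsLinePoint L τ T v₃ x →
          ∀ d : finAdelic (↥(maximalRealSubfield L)) L (IsCMField.complexConj L) 3 H,
            IsDiagTwist L H v₃ (recipFactor L s) d →
            ∀ a : finAdelic (↥(maximalRealSubfield L)) L (IsCMField.complexConj L) 3 H,
              σ • (AlgPoints.baseChangeEquiv ιE (M.obj K)).symm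
                  (AlgPoints.map (e.inv.app K) ((Sc.pts K).symm (ShimuraSet.mk L H τ T hT K.1.1 x a))) =
                (AlgPoints.baseChangeEquiv ιE (M.obj K)).symm
                  (AlgPoints.map (e.inv.app K)
                    ((Sc.pts K).symm (ShimuraSet.mk L H τ T hT K.1.1 x (d * a)))) := by
  obtain ⟨j, hj⟩ := exists_comp_eq_of_range_subset ιE ιE' hEE
  exact exists_form_of_comp_eq Sc j ιE ιE' hj M' e' h'

/-- **Tower lemma, consumer shape (`∀ E ⊇ τ(L)·S`).**  If `Sc.Mc` has a form with reciprocity (62) over some field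
`E₁` whose image `ι₁(E₁) ⊆ ℂ` lies in the subfield generated by `τ(L) ∪ S` (`S ⊆ ℂ` any set — for the consumer, the
reflex-trace field `E*(Φ)` of a CM type, so that `τ(L)·S` is the reflex compositum `E♯_Φ`), then it has an `E`-form
with reciprocity (62) for `Aut(ℂ/E)` over EVERY field `E`, `ιE : E →+* ℂ`, with `τ(L) ⊆ ιE(E)` and `S ⊆ ιE(E)`:
such `ιE(E)` is a subfield containing `τ(L) ∪ S`, hence the subfield they generate, hence `ι₁(E₁)`
(`exists_form_of_range_subset`).  The conclusion is VERBATIM the `∀ E`-clause of the consumer statement (its unused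
`[NumberField E]` binder included). [cite: Deligne1971TravauxShimura, Déf. 3.13 p. 141 and Prop. 5.10 p. 157]
[cite: Milne2005ShimuraVarieties, Def. 12.8 (62) p. 114] -/
theorem forall_exists_form_of_subset_closure (S : Set ℂ) {E₁ : Type} [Field E₁] (ι₁ : E₁ →+* ℂ)
    (hgen : Set.range ι₁ ⊆ Subfield.closure (Set.range τ ∪ S)) (M₁ : C5.SmallLevel K₀ ⥤ SchemeOver E₁)
    (e₁ : (M₁ ⋙ baseChangeHom ι₁) ≅ Sc.Mc)
    (h₁ : letI : Algebra E₁ ℂ := ι₁.toAlgebra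
      ∀ (K : C5.SmallLevel K₀) (σ : ℂ ≃ₐ[E₁] ℂ) (s : (FiniteAdeleRing (𝓞 L) L)ˣ),
        IsArtinCorrespondent L τ s σ.toRingEquiv →
        ∀ (v₃ : Fin 3 → L) (x : Ball), IsLinePoint L τ T v₃ x →
          ∀ d : finAdelic (↥(maximalRealSubfield L)) L (IsCMField.complexConj L) 3 H,
            IsDiagTwist L H v₃ (recipFactor L s) d →
            ∀ a : finAdelic (↥(maximalRealSubfield L)) L (IsCMField.complexConj L) 3 H,
              σ • (AlgPoints.baseChangeEquiv ι₁ (M₁.obj K)).symm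
                  (AlgPoints.map (e₁.inv.app K) ((Sc.pts K).symm (ShimuraSet.mk L H τ T hT K.1.1 x a))) =
                (AlgPoints.baseChangeEquiv ι₁ (M₁.obj K)).symm
                  (AlgPoints.map (e₁.inv.app K)
                    ((Sc.pts K).symm (ShimuraSet.mk L H τ T hT K.1.1 x (d * a))))) :
    ∀ (E : Type) [Field E] [NumberField E] (ιE : E →+* ℂ),
      Set.range τ ⊆ Set.range ιE → S ⊆ Set.range ιE →
      ∃ (M : C5.SmallLevel K₀ ⥤ SchemeOver E) (e : (M ⋙ baseChangeHom ιE) ≅ Sc.Mc),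
        letI : Algebra E ℂ := ιE.toAlgebra
        ∀ (K : C5.SmallLevel K₀) (σ : ℂ ≃ₐ[E] ℂ) (s : (FiniteAdeleRing (𝓞 L) L)ˣ),
          IsArtinCorrespondent L τ s σ.toRingEquiv →
          ∀ (v₃ : Fin 3 → L) (x : Ball), IsLinePoint L τ T v₃ x →
            ∀ d : finAdelic (↥(maximalRealSubfield L)) L (IsCMField.complexConj L) 3 H,
              IsDiagTwist L H v₃ (recipFactor L s) d →
              ∀ a : finAdelic (↥(maximalRealSubfield L)) L (IsCMField.complexConj L) 3 H,
                σ • (AlgPoints.baseChangeEquiv ιE (M.obj K)).symm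
                    (AlgPoints.map (e.inv.app K) ((Sc.pts K).symm (ShimuraSet.mk L H τ T hT K.1.1 x a))) =
                  (AlgPoints.baseChangeEquiv ιE (M.obj K)).symm
                    (AlgPoints.map (e.inv.app K)
                      ((Sc.pts K).symm (ShimuraSet.mk L H τ T hT K.1.1 x (d * a)))) := by
  intro E _ _ ιE hτ hS
  have hle : Subfield.closure (Set.range τ ∪ S) ≤ ιE.fieldRange :=
    Subfield.closure_le.mpr (by rw [RingHom.coe_fieldRange]; exact Set.union_subset hτ hS)
  have hEE : Set.range ι₁ ⊆ Set.range ιE := fun z hz => RingHom.mem_fieldRange.mp (hle (hgen hz))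
  exact exists_form_of_range_subset Sc ιE ι₁ hEE M₁ e₁ h₁

end Forms

end UnitaryCanonicalModel

end Literature.AlgebraicGeometry.ShimuraVarieties

end
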